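import Summits.SmoothPoincare4.SmoothPoincare4.Theorems.CongruenceShadowsGriffithsHandlebodyExtensionCoverPlanarB
import Summits.SmoothPoincare4.SmoothPoincare4.Theorems.CongruenceShadowsGriffithsHandlebodyExtensionCoverPlanarD
import HarnessLib

/-!
# SmoothPoincare4 / CongruenceShadows — `GriffithsHandlebodyExtension` (item stmt-SmoothPoincare4-15190): the planar family (E3), C.1 — closing data and the monodromy

Support file (`--supports` stmt-SmoothPoincare4-15190) of the homothety-cover proof of the genus-one
clause (E) of Griffiths' handlebody extension theorem — *every self-diffeomorphism of the Heegaard torus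
`∂V` of the round solid torus fixing the base point and acting trivially on `π₁(∂V)` extends to a
self-diffeomorphism of `V`* (hypothesis `hE` of
`Literature.Topology.FourManifolds.RoundSolidTorusModel.diffeoExtends_of_map_ker_eq_ker_of_forall_diffeoExtends`).
See the module docstring of `…CoverDefs` for the whole line (E1–E6) and the notation
(`τ̂`, `δ_λ`, `ρ`, `χ`, `f`, `Δ^(c)`, `α`, `L`, `M`, `Ψ̂`, `ẽ_c`).

This part (E3-C, first third): log-periodicity lemmas, the conjugation lemma (a homeomorphism of the plane fixing the
annulus maps the unit disc onto itself), the clamp and time profile, the closing data `PI.CD` (isotopy `Φ`, base disc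
`e₀`, collar width `η`) and the monodromy `h_v = Φ_v⁻¹ ∘ Φ_{v-1}`, which fixes `τ(A)` and preserves `{‖τ' w‖ < 1}`.
-/

-- the registered namespace `Summit.SmoothPoincare4.SmoothPoincare4.Theorems` repeats a component
set_option linter.dupNamespace false

noncomputable section

namespace Summit.SmoothPoincare4.SmoothPoincare4.Theorems

namespace HomothetyCover

open Set Function Metric Filter
open scoped Topology ContDiff

namespace Planar

open Set Function Metric Filter
open scoped Topology ContDiff Manifold
open Literature.Topology.FourManifolds
attribute [local instance] factFinrankE2
variable {lam : ℝ} (P : PI lam)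

section Closing

variable {lam : ℝ} (P : PI lam)

namespace PI

/-! ### C-i. Generic facts -/

/-- `S_{t+n} = S_t` for natural `n` (log-periodicity of the conjugated family). -/
theorem S_add_nat (hlam : 0 < lam) (n : ℕ) (t : ℝ) (u : E2) : P.S (t + n) u = P.S t u := by
  induction n with
  | zero => simp
  | succ n ih => rw [Nat.cast_succ, ← add_assoc, P.S_add_one hlam, ih]

/-- `S_{t+m} = S_t` for integer `m`. -/
theorem S_add_int (hlam : 0 < lam) (m : ℤ) (t : ℝ) (u : E2) : P.S (t + m) u = P.S t u := by
  obtain ⟨n, rfl | rfl⟩ := m.eq_nat_or_neg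
  · exact_mod_cast P.S_add_nat hlam n t u
  · have h := P.S_add_nat hlam n (t + ((-(n : ℤ) : ℤ) : ℝ)) u
    rw [show t + ((-(n : ℤ) : ℤ) : ℝ) + (n : ℝ) = t by push_cast; ring] at h
    exact h.symm

/-- `λ^{log c / log λ} = c` for `c > 0`. -/
theorem cexp_log (hlam : 1 < lam) {c : ℝ} (hc : 0 < c) : cexp lam (Real.log c / Real.log lam) = c := by
  rw [cexp, div_mul_cancel₀ _ (Real.log_pos hlam).ne', Real.exp_log hc]

end PI

/-- **The conjugation lemma**: a homeomorphism of the plane fixing the annulus `A` pointwise maps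
the open unit disc onto itself (connectivity), hence also the unit circle and the closed disc. -/
theorem image_ball_of_fix_ann {ψ ψ' : E2 → E2} (hψ : Continuous ψ) (hψ' : Continuous ψ')
    (h1 : ∀ x, ψ' (ψ x) = x) (h2 : ∀ x, ψ (ψ' x) = x) (hfix : ∀ u ∈ PI.ann, ψ u = u) :
    ψ '' ball (0 : E2) 1 = ball 0 1 := by
  -- a point of the annulus inside the disc
  set u₀ : E2 := (3 / 4 : ℝ) • EuclideanSpace.single (0 : Fin 2) (1 : ℝ) with hu₀
  have hn₀ : ‖u₀‖ = 3 / 4 := by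
    rw [hu₀, norm_smul]; simp
  have hu₀ann : u₀ ∈ PI.ann := by
    refine ⟨by rw [hn₀]; norm_num, by rw [hn₀]; norm_num⟩
  have hu₀ball : u₀ ∈ ball (0 : E2) 1 := by rw [mem_ball_zero_iff, hn₀]; norm_num
  have hfix' : ∀ u ∈ PI.ann, ψ' u = u := fun u hu => by
    conv_lhs => rw [← hfix u hu]; exact h1 u
  -- generic inclusion for a homeomorphism fixing the annulus
  have key : ∀ {f g : E2 → E2}, Continuous f → (∀ x, g (f x) = x) → (∀ u ∈ PI.ann, f u = u) →
      f '' ball (0 : E2) 1 ⊆ ball 0 1 := by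
    intro f g hf hgf hffix
    have hinj : Injective f := fun a b h => by have := congrArg g h; rwa [hgf, hgf] at this
    have hconn : IsPreconnected (f '' ball (0 : E2) 1) := isPreconnected_ball.image _ hf.continuousOn
    have hsub : f '' ball (0 : E2) 1 ⊆ ball 0 1 ∪ (closedBall 0 1)ᶜ := by
      rintro _ ⟨x, hx, rfl⟩
      by_cases hs : f x ∈ sphere (0 : E2) 1
      · exfalso
        have hsann : f x ∈ PI.ann := ⟨by rw [norm_eq_of_mem_sphere ⟨_, hs⟩]; norm_num,
          by rw [norm_eq_of_mem_sphere ⟨_, hs⟩]; norm_num⟩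
        have : f (f x) = f x := hffix _ hsann
        have hx' := hinj this
        rw [hx'] at hs
        rw [mem_ball_zero_iff] at hx
        rw [mem_sphere_zero_iff_norm] at hs
        linarith
      · rw [mem_sphere_zero_iff_norm] at hs
        rcases lt_or_gt_of_ne hs with h | h
        · exact Or.inl (mem_ball_zero_iff.2 h)
        · exact Or.inr (fun hc => by rw [mem_closedBall_zero_iff] at hc; linarith)
    have hdisj : Disjoint (ball (0 : E2) 1) (closedBall 0 1)ᶜ :=
      disjoint_compl_right.mono_left ball_subset_closedBall
    exact hconn.subset_left_of_subset_union isOpen_ball isClosed_closedBall.isOpen_compl hdisj hsub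
      ⟨u₀, ⟨u₀, hu₀ball, hffix u₀ hu₀ann⟩, hu₀ball⟩
  refine Subset.antisymm (key hψ h1 hfix) fun x hx => ?_
  have := key hψ' h2 hfix' ⟨x, hx, rfl⟩
  exact ⟨ψ' x, this, h2 x⟩

/-- A map fixing the annulus pointwise maps the unit circle onto itself. -/
theorem image_sphere_of_fix_ann {ψ : E2 → E2} (hfix : ∀ u ∈ PI.ann, ψ u = u) :
    ψ '' sphere (0 : E2) 1 = sphere 0 1 := by
  have hs : ∀ u ∈ sphere (0 : E2) 1, u ∈ PI.ann := fun u hu =>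
    ⟨by rw [norm_eq_of_mem_sphere ⟨u, hu⟩]; norm_num, by rw [norm_eq_of_mem_sphere ⟨u, hu⟩]; norm_num⟩
  ext w; constructor
  · rintro ⟨u, hu, rfl⟩; rw [hfix u (hs u hu)]; exact hu
  · intro hw; exact ⟨w, hw, hfix w (hs w hw)⟩

/-- A homeomorphism of the plane fixing the annulus pointwise maps the closed unit disc onto itself. -/
theorem image_closedBall_of_fix_ann {ψ ψ' : E2 → E2} (hψ : Continuous ψ) (hψ' : Continuous ψ')
    (h1 : ∀ x, ψ' (ψ x) = x) (h2 : ∀ x, ψ (ψ' x) = x) (hfix : ∀ u ∈ PI.ann, ψ u = u) :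
    ψ '' closedBall (0 : E2) 1 = closedBall 0 1 := by
  rw [← ball_union_sphere, image_union, image_ball_of_fix_ann hψ hψ' h1 h2 hfix,
    image_sphere_of_fix_ann hfix]

/-! ### The tclamp and the time profile -/

/-- Smooth tclamp: identity on `[3/4, 5/4]`, constant `3/4` below `5/8`, constant `5/4` above `11/8`,
all values in `[5/8, 11/8]`. -/
def tclamp (u : ℝ) : ℝ :=
  u + (3 / 4 - u) * Real.smoothTransition ((3 / 4 - u) / (1 / 8)) +
    (5 / 4 - u) * Real.smoothTransition ((u - 5 / 4) / (1 / 8))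

/-- The tclamp is smooth. -/
theorem contDiff_tclamp : ContDiff ℝ ∞ tclamp := by
  unfold tclamp
  refine (contDiff_id.add ((contDiff_const.sub contDiff_id).mul
    (Real.smoothTransition.contDiff.comp ((contDiff_const.sub contDiff_id).div_const _)))).add
    ((contDiff_const.sub contDiff_id).mul
      (Real.smoothTransition.contDiff.comp ((contDiff_id.sub contDiff_const).div_const _)))

/-- The tclamp is the identity on `[3/4, 5/4]`. -/
theorem tclamp_of_mem {u : ℝ} (hu : u ∈ Icc (3 / 4 : ℝ) (5 / 4)) : tclamp u = u := by
  rw [tclamp, Real.smoothTransition.zero_of_nonpos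
      (div_nonpos_of_nonpos_of_nonneg (by linarith [hu.1]) (by norm_num)),
    Real.smoothTransition.zero_of_nonpos (x := (u - 5 / 4) / (1 / 8))
      (div_nonpos_of_nonpos_of_nonneg (by linarith [hu.2]) (by norm_num))]
  ring

/-- The tclamp takes values in `[5/8, 11/8]`. -/
theorem tclamp_mem (u : ℝ) : tclamp u ∈ Icc (5 / 8 : ℝ) (11 / 8) := by
  have h0a := Real.smoothTransition.nonneg ((3 / 4 - u) / (1 / 8))
  have h1a := Real.smoothTransition.le_one ((3 / 4 - u) / (1 / 8))
  have h0b := Real.smoothTransition.nonneg ((u - 5 / 4) / (1 / 8))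
  have h1b := Real.smoothTransition.le_one ((u - 5 / 4) / (1 / 8))
  rw [tclamp]
  rcases le_or_gt u (3 / 4) with hu1 | hu1
  · have hb : Real.smoothTransition ((u - 5 / 4) / (1 / 8)) = 0 :=
      Real.smoothTransition.zero_of_nonpos (div_nonpos_of_nonpos_of_nonneg (by linarith) (by norm_num))
    rw [hb, mul_zero, add_zero]
    rcases le_or_gt u (5 / 8) with hu2 | hu2
    · have ha : Real.smoothTransition ((3 / 4 - u) / (1 / 8)) = 1 :=
        Real.smoothTransition.one_of_one_le (by rw [le_div_iff₀ (by norm_num)]; linarith)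
      rw [ha]; constructor <;> linarith
    · constructor <;> nlinarith
  · have ha : Real.smoothTransition ((3 / 4 - u) / (1 / 8)) = 0 :=
      Real.smoothTransition.zero_of_nonpos (div_nonpos_of_nonpos_of_nonneg (by linarith) (by norm_num))
    rw [ha, mul_zero, add_zero]
    rcases le_or_gt (11 / 8) u with hu2 | hu2
    · have hb : Real.smoothTransition ((u - 5 / 4) / (1 / 8)) = 1 :=
        Real.smoothTransition.one_of_one_le (by rw [le_div_iff₀ (by norm_num)]; linarith)
      rw [hb]; constructor <;> linarith
    · constructor <;> nlinarith

/-- Time profile: `0` for `t ≤ 1/4`, `1` for `t ≥ 1/2`. -/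
def θ₁ (t : ℝ) : ℝ := Real.smoothTransition (4 * t - 1)

/-- The time profile `θ₁` is smooth. -/
theorem contDiff_θ₁ : ContDiff ℝ ∞ θ₁ :=
  Real.smoothTransition.contDiff.comp ((contDiff_const.mul contDiff_id).sub contDiff_const)

/-- `θ₁ = 0` on `(-∞, 1/4]`. -/
theorem θ₁_of_le {t : ℝ} (ht : t ≤ 1 / 4) : θ₁ t = 0 :=
  Real.smoothTransition.zero_of_nonpos (by linarith)

/-- `θ₁ = 1` on `[1/2, ∞)`. -/
theorem θ₁_of_ge {t : ℝ} (ht : 1 / 2 ≤ t) : θ₁ t = 1 :=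
  Real.smoothTransition.one_of_one_le (by linarith)

end Closing

/-! ### C-ii. Closing data, the correction family `H_u`, Smale in families -/

section ClosingData

variable {lam : ℝ} {P : PI lam}

namespace PI

/-- The open annulus `{1/2 < ‖u‖ < 2}`. -/
def annInt : Set E2 := {u | 1 / 2 < ‖u‖ ∧ ‖u‖ < 2}

/-- The open annulus lies in the closed one. -/
theorem annInt_subset_ann : annInt ⊆ ann := fun _ hu => ⟨hu.1.le, hu.2.le⟩

variable (P) in
/-- **Closing data**: the ambient isotopy of Part A, the base embedding of Part B, and a collar
width `η` such that `e₀` maps the `η`-collar of the unit circle into `τ(annInt)`. -/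
structure CD where
  /-- the ambient isotopy of Part A -/
  Φ : ℝ → E2 → E2
  /-- its fibrewise inverse -/
  Φ' : ℝ → E2 → E2
  /-- `Φ` is jointly smooth -/
  hΦ : ContDiff ℝ ∞ (uncurry Φ)
  /-- `Φ'` is jointly smooth -/
  hΦ' : ContDiff ℝ ∞ (uncurry Φ')
  /-- `Φ'_t ∘ Φ_t = id` -/
  Φ'Φ : ∀ t w, Φ' t (Φ t w) = w
  /-- `Φ_t ∘ Φ'_t = id` -/
  ΦΦ' : ∀ t w, Φ t (Φ' t w) = w
  /-- `Φ_0 = id` -/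
  Φ0 : ∀ w, Φ 0 w = w
  /-- `Φ_t ∘ τ = S_t` on the annulus for `t ∈ (-1, 2)` -/
  track : ∀ t ∈ Ioo (-1 : ℝ) 2, ∀ u ∈ ann, Φ t (P.τ u) = P.S t u
  /-- the base embedding of Part B -/
  e₀ : E2 → E2
  /-- its left inverse -/
  e₀' : E2 → E2
  /-- `e₀` is smooth -/
  he₀ : ContDiff ℝ ∞ e₀
  /-- `e₀' ∘ e₀ = id` -/
  e₀'e₀ : ∀ x, e₀' (e₀ x) = x
  /-- `e₀'` is smooth at image points -/
  he₀' : ∀ x, ContDiffAt ℝ ∞ e₀' (e₀ x)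
  /-- `e₀ = τ` on the unit circle -/
  bdry : ∀ u : E2, ‖u‖ = 1 → e₀ u = P.τ u
  /-- `e₀` maps the closed unit disc onto `{‖τ' w‖ ≤ 1}` -/
  img_closedBall : e₀ '' closedBall (0 : E2) 1 = {w | ‖P.τ' w‖ ≤ 1}
  /-- `e₀` maps the open unit disc onto `{‖τ' w‖ < 1}` -/
  img_ball : e₀ '' ball (0 : E2) 1 = {w | ‖P.τ' w‖ < 1}
  /-- the collar width -/
  η : ℝ
  /-- `η > 0` -/
  η_pos : 0 < η
  /-- `η ≤ 1/2` -/
  η_le : η ≤ 1 / 2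
  /-- `e₀` maps the `η`-collar of the unit circle into `τ(annInt)` -/
  collar : ∀ z : E2, |‖z‖ - 1| < η → P.τ' (e₀ z) ∈ annInt

variable (P) in
/-- Closing data exist (Parts A and B, and compactness of the circle). -/
theorem nonempty_CD (hlam : 1 < lam) : Nonempty (CD P) := by
  obtain ⟨Φ, Φ', hΦ, hΦ', h1, h2, h0, htrack⟩ := P.exists_isotopy
  obtain ⟨e₀, e₀', he₀, he₀'e₀, he₀', hbdry, hcl, hball⟩ := P.exists_base hlam
  -- the collar width
  have hopen : IsOpen (e₀ ⁻¹' (P.τ' ⁻¹' annInt)) := by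
    refine ((isOpen_lt continuous_const continuous_norm).inter
      (isOpen_lt continuous_norm continuous_const)).preimage (P.continuous_τ' hlam) |>.preimage he₀.continuous
  have hsub : sphere (0 : E2) 1 ⊆ e₀ ⁻¹' (P.τ' ⁻¹' annInt) := by
    intro u hu
    have hn : ‖u‖ = 1 := norm_eq_of_mem_sphere ⟨u, hu⟩
    show P.τ' (e₀ u) ∈ annInt
    rw [hbdry u hn, P.τ'_τ]; exact ⟨by rw [hn]; norm_num, by rw [hn]; norm_num⟩
  obtain ⟨δ, hδ, hthick⟩ := (isCompact_sphere (0 : E2) 1).exists_thickening_subset_open hopen hsub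
  refine ⟨⟨Φ, Φ', hΦ, hΦ', h1, h2, h0, htrack, e₀, e₀', he₀, he₀'e₀, he₀', hbdry, hcl, hball,
    min δ (1 / 2), lt_min hδ (by norm_num), min_le_right _ _, fun z hz => ?_⟩⟩
  have hz' : |‖z‖ - 1| < δ := lt_of_lt_of_le hz (min_le_left _ _)
  have hz0 : z ≠ 0 := by
    intro h; rw [h, norm_zero] at hz; have := min_le_right δ (1 / 2 : ℝ)
    rw [zero_sub, abs_neg, abs_one] at hz; linarith
  have hmem : z ∈ Metric.thickening δ (sphere (0 : E2) 1) := by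
    rw [Metric.mem_thickening_iff]
    refine ⟨‖z‖⁻¹ • z, by simp [norm_smul, inv_mul_cancel₀ (norm_ne_zero_iff.2 hz0)], ?_⟩
    have : z - ‖z‖⁻¹ • z = (1 - ‖z‖⁻¹) • z := by rw [sub_smul, one_smul]
    rw [dist_eq_norm, this, norm_smul, Real.norm_eq_abs]
    have hn : 0 < ‖z‖ := norm_pos_iff.2 hz0
    have e : |1 - ‖z‖⁻¹| * ‖z‖ = |‖z‖ - 1| := by
      rw [show (1 - ‖z‖⁻¹) = (‖z‖ - 1) * ‖z‖⁻¹ by field_simp, abs_mul, abs_inv, abs_of_pos hn]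
      field_simp
    rw [e]; exact hz'
  exact hthick hmem

namespace CD

variable (D : CD P)

/-! #### The collar agreement `Φ_{t+1} ∘ τ = Φ_t ∘ τ` on the annulus -/

/-- **Collar agreement**: `Φ_{t+1} ∘ τ = Φ_t ∘ τ` on the annulus, `t ∈ (-1, 1)` (log-periodicity of `S`). -/
theorem Φ_add_one_τ (hlam : 0 < lam) {t : ℝ} (ht : t ∈ Ioo (-1 : ℝ) 1) {u : E2} (hu : u ∈ ann) :
    D.Φ (t + 1) (P.τ u) = D.Φ t (P.τ u) := by
  rw [D.track (t + 1) ⟨by linarith [ht.1], by linarith [ht.2]⟩ u hu,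
    D.track t ⟨ht.1, by linarith [ht.2]⟩ u hu, P.S_add_one hlam]

/-- The monodromy `h_v = Φ'_v ∘ Φ_{v-1}` and its inverse. -/
def hmap (v : ℝ) (w : E2) : E2 := D.Φ' v (D.Φ (v - 1) w)

/-- Inverse monodromy. -/
def hmap' (v : ℝ) (w : E2) : E2 := D.Φ' (v - 1) (D.Φ v w)

/-- `h'_v ∘ h_v = id`. -/
theorem hmap'_hmap (v : ℝ) (w : E2) : D.hmap' v (D.hmap v w) = w := by simp [hmap, hmap', D.ΦΦ', D.Φ'Φ]

/-- `h_v ∘ h'_v = id`. -/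
theorem hmap_hmap' (v : ℝ) (w : E2) : D.hmap v (D.hmap' v w) = w := by simp [hmap, hmap', D.ΦΦ', D.Φ'Φ]

/-- `h_v` fixes `τ(ann)` pointwise for `v ∈ (0, 2)`. -/
theorem hmap_τ (hlam : 0 < lam) {v : ℝ} (hv : v ∈ Ioo (0 : ℝ) 2) {u : E2} (hu : u ∈ ann) :
    D.hmap v (P.τ u) = P.τ u := by
  have ht : v - 1 ∈ Ioo (-1 : ℝ) 1 := ⟨by linarith [hv.1], by linarith [hv.2]⟩
  rw [hmap, ← D.Φ_add_one_τ hlam ht hu, sub_add_cancel, D.Φ'Φ]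

/-- `h'_v` fixes `τ(A)` pointwise for `v ∈ (0, 2)`. -/
theorem hmap'_τ (hlam : 0 < lam) {v : ℝ} (hv : v ∈ Ioo (0 : ℝ) 2) {u : E2} (hu : u ∈ ann) :
    D.hmap' v (P.τ u) = P.τ u := by
  conv_lhs => rw [← D.hmap_τ hlam hv hu]
  exact D.hmap'_hmap v _

/-- `(v, w) ↦ h_v w` is smooth. -/
theorem contDiff_hmap_uncurry : ContDiff ℝ ∞ (fun q : ℝ × E2 => D.hmap q.1 q.2) := by
  unfold hmap
  have h1 : ContDiff ℝ ∞ (fun q : ℝ × E2 => D.Φ (q.1 - 1) q.2) :=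
    D.hΦ.comp ((contDiff_fst.sub contDiff_const).prodMk contDiff_snd)
  exact D.hΦ'.comp (contDiff_fst.prodMk h1)

/-- `(v, w) ↦ h'_v w` is smooth. -/
theorem contDiff_hmap'_uncurry : ContDiff ℝ ∞ (fun q : ℝ × E2 => D.hmap' q.1 q.2) := by
  unfold hmap'
  have h1 : ContDiff ℝ ∞ (fun q : ℝ × E2 => D.Φ q.1 q.2) := D.hΦ.comp (contDiff_fst.prodMk contDiff_snd)
  exact D.hΦ'.comp ((contDiff_fst.sub contDiff_const).prodMk h1)

/-- `h_v` maps the inside `{‖τ' w‖ < 1}` onto itself (conjugate by `τ` and use the conjugation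
lemma). -/
theorem hmap_image_Tint (hlam : 1 < lam) {v : ℝ} (hv : v ∈ Ioo (0 : ℝ) 2) :
    D.hmap v '' {w | ‖P.τ' w‖ < 1} = {w | ‖P.τ' w‖ < 1} := by
  have hl : 0 < lam := lt_trans zero_lt_one hlam
  have hτc := P.continuous_τ hlam
  have hτ'c := P.continuous_τ' hlam
  set ψ : E2 → E2 := fun x => P.τ' (D.hmap v (P.τ x)) with hψ
  set ψ' : E2 → E2 := fun x => P.τ' (D.hmap' v (P.τ x)) with hψ'
  have hψc : Continuous ψ := hτ'c.comp ((D.contDiff_hmap_uncurry.continuous.comp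
    (continuous_const.prodMk hτc)))
  have hψ'c : Continuous ψ' := hτ'c.comp ((D.contDiff_hmap'_uncurry.continuous.comp
    (continuous_const.prodMk hτc)))
  have h1 : ∀ x, ψ' (ψ x) = x := fun x => by simp [hψ, hψ', P.τ_τ', D.hmap'_hmap, P.τ'_τ]
  have h2 : ∀ x, ψ (ψ' x) = x := fun x => by simp [hψ, hψ', P.τ_τ', D.hmap_hmap', P.τ'_τ]
  have hfix : ∀ u ∈ ann, ψ u = u := fun u hu => by simp [hψ, D.hmap_τ hl hv hu, P.τ'_τ]
  have key := image_ball_of_fix_ann hψc hψ'c h1 h2 hfix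
  rw [← P.image_τ_ball, ← image_comp]
  have : D.hmap v ∘ P.τ = P.τ ∘ ψ := by funext x; simp [hψ, P.τ_τ']
  rw [this, image_comp, key]

end CD

end PI

end ClosingData

end Planar

end HomothetyCover

end Summit.SmoothPoincare4.SmoothPoincare4.Theorems

end
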